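import Mathlib
import HarnessLib
import Summits.HubbardSuperconductivity.HubbardSuperconductivity.Theorems.WeakCouplingBCSKlLindhardEnclosureGate

/-!
# KL-MARGIN-SCAN reader (22) «kernel-lindhard-enclosure» — TIP RULE, mean-value layer (generic calculus; cell gate-hubbard-kl, seat p4 g25)

Second generic file of the TIP RULE (`Params.ceilTip`, `…LindhardEnclosureKernel` §3b) after `…LindhardEnclosureTipCore` (slice and outer integrals).
Here: the SLICE DATA and the CROSS-SLICE lower bound, for plain real functions (no records, no `Params`):

* §1 `tip_pointwise_shift` — the pointwise majorant with an offset `a ≥ 0`: `a + v·d ≤ |e₁|`, `c − m·d ≤ |e₂|` ⇒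
  `1/(|e₁| + |e₂|) ≤ (1 + m/v)/(v·d + (a + c))`;
* §2 one-variable growth: `exists_abs_ge_add_mul` — `f′ ≥ v` (or `≤ −v`) everywhere ⇒ on `[y₀, y₁]` there is `y⋆` with
  `|f y⋆| + v|y − y⋆| ≤ |f y|`; `abs_sub_abs_le_mul_of_deriv` — `|g′| ≤ m` ⇒ `|g y⋆| − m|y − y⋆| ≤ |g y|`;
* §3 `mv_lower_bound_rect` — for `f, g : ℝ → ℝ → ℝ` with partial derivatives `fx fy gx gy` (separately, everywhere), on a rectangle where
  every mixed choice of entries has `|fx·gy − fy·gx| ≥ J` and `|∂| ≤ L`: `J·max(|x − x′|, |y − y′|) ≤ L·(|f(x,y) − f(x′,y′)| + |g(x,y) − g(x′,y′)|)`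
  (two axis-parallel mean values per function + Gate §5 `mv_matrix_bound`); `sum_abs_ge_of_isMinOn` — at a minimiser `(x′, y′)` of `|f| + |g|`:
  `(J/(2L))·max(|x − x′|, |y − y′|) ≤ |f(x,y)| + |g(x,y)|`; `exists_isMinOn_rect` (compactness).

Honest framing: calculus lemmas only; nothing here asserts `CeilTipSoundOrd`, a χ₀ enclosure, a margin, `K₃`, `U₀`, the window or superconductivity.
References: idea-4 r11 Core §3b/§5 (tree: `…LindhardEnclosureKernel`, `…LindhardEnclosureGate`).
-/

noncomputable section

set_option linter.dupNamespace false

namespace Summit.HubbardSuperconductivity.HubbardSuperconductivity.Theorems.KlLindhardEnclosure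

open Real Set

/-! ## §1 The pointwise majorant with an offset -/

/-- **Pointwise tip majorant with offset**: `a + v·d ≤ |e₁|`, `c − m·d ≤ |e₂|` (`v > 0`, `m, a ≥ 0`, `v·d + (a + c) > 0`) ⇒
`1/(|e₁| + |e₂|) ≤ (1 + m/v)/(v·d + (a + c))` (Gate §5 `tip_slice_ineq`). [folklore] -/
theorem tip_pointwise_shift {e₁ e₂ v m a c d : ℝ} (hv : 0 < v) (hm : 0 ≤ m) (ha : 0 ≤ a)
    (h1 : a + v * d ≤ |e₁|) (h2 : c - m * d ≤ |e₂|) (hpos : 0 < v * d + (a + c)) :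
    1 / (|e₁| + |e₂|) ≤ (1 + m / v) / (v * d + (a + c)) := by
  have hl : 0 ≤ m / v := div_nonneg hm hv.le
  have ha' : 0 ≤ |e₁| - v * d := by linarith
  have key := tip_slice_ineq (a := |e₁| - v * d) (w := v * d) (c := c) (l := m / v) ha' hl
  have hmvd : m / v * (v * d) = m * d := by field_simp
  rw [hmvd, show |e₁| - v * d + v * d = |e₁| by ring] at key
  have hmax : max 0 (c - m * d) ≤ |e₂| := max_le (abs_nonneg _) h2
  have hsum : (|e₁| + c) / (1 + m / v) ≤ |e₁| + |e₂| := by linarith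
  have h1l : 0 < 1 + m / v := by linarith
  have hq : 0 < (v * d + (a + c)) / (1 + m / v) := div_pos hpos h1l
  have hq' : (v * d + (a + c)) / (1 + m / v) ≤ (|e₁| + c) / (1 + m / v) :=
    div_le_div_of_nonneg_right (by linarith) h1l.le
  have hE : 0 < |e₁| + |e₂| := lt_of_lt_of_le hq (hq'.trans hsum)
  rw [div_le_div_iff₀ hE hpos]
  calc 1 * (v * d + (a + c)) ≤ |e₁| + c := by linarith
    _ = (1 + m / v) * ((|e₁| + c) / (1 + m / v)) := by field_simp
    _ ≤ (1 + m / v) * (|e₁| + |e₂|) := by gcongr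

/-! ## §2 One-variable growth lemmas -/

/-- Growth from a derivative floor: `f′ ≥ v` everywhere ⇒ `v·(y − x) ≤ f y − f x` for `x ≤ y`. [folklore] -/
theorem mul_sub_le_sub_of_hasDerivAt_ge {f f' : ℝ → ℝ} (hf : ∀ y, HasDerivAt f (f' y) y) {v : ℝ} (hv : ∀ y, v ≤ f' y)
    {x y : ℝ} (hxy : x ≤ y) : v * (y - x) ≤ f y - f x := by
  have hcont : ContinuousOn f univ := fun z _ => (hf z).continuousAt.continuousWithinAt
  have hdiff : DifferentiableOn ℝ f (interior univ) := fun z _ => (hf z).differentiableAt.differentiableWithinAt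
  have hge : ∀ z ∈ interior (univ : Set ℝ), v ≤ deriv f z := fun z _ => by rw [(hf z).deriv]; exact hv z
  exact convex_univ.mul_sub_le_image_sub_of_le_deriv hcont hdiff hge x (mem_univ x) y (mem_univ y) hxy

/-- Lipschitz from a derivative bound: `|g′| ≤ m` everywhere ⇒ `|g y − g x| ≤ m·|y − x|`. [folklore] -/
theorem abs_sub_le_mul_abs_of_hasDerivAt {g g' : ℝ → ℝ} (hg : ∀ y, HasDerivAt g (g' y) y) {m : ℝ} (hm : ∀ y, |g' y| ≤ m)
    (x y : ℝ) : |g y - g x| ≤ m * |y - x| := by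
  have hcont : ContinuousOn g univ := fun z _ => (hg z).continuousAt.continuousWithinAt
  have hdiff : DifferentiableOn ℝ g (interior univ) := fun z _ => (hg z).differentiableAt.differentiableWithinAt
  have hle : ∀ z ∈ interior (univ : Set ℝ), deriv g z ≤ m := fun z _ => by rw [(hg z).deriv]; exact (abs_le.1 (hm z)).2
  have hge : ∀ z ∈ interior (univ : Set ℝ), -m ≤ deriv g z := fun z _ => by rw [(hg z).deriv]; exact (abs_le.1 (hm z)).1
  rcases le_total x y with hxy | hxy
  · have h1 := convex_univ.image_sub_le_mul_sub_of_deriv_le hcont hdiff hle x (mem_univ x) y (mem_univ y) hxy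
    have h2 := convex_univ.mul_sub_le_image_sub_of_le_deriv hcont hdiff hge x (mem_univ x) y (mem_univ y) hxy
    rw [abs_of_nonneg (sub_nonneg.2 hxy), abs_le]
    exact ⟨by linarith, h1⟩
  · have h1 := convex_univ.image_sub_le_mul_sub_of_deriv_le hcont hdiff hle y (mem_univ y) x (mem_univ x) hxy
    have h2 := convex_univ.mul_sub_le_image_sub_of_le_deriv hcont hdiff hge y (mem_univ y) x (mem_univ x) hxy
    rw [abs_of_nonpos (sub_nonpos.2 hxy), abs_le]
    exact ⟨by linarith, by linarith⟩

/-- **Slice datum for the monotone function**: if `f′ ≥ v > 0` everywhere, then on `[y₀, y₁]` there is `y⋆` (the zero of `f` if it changes sign, else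
the endpoint where `|f|` is least) with `|f y⋆| + v·|y − y⋆| ≤ |f y|` for all `y ∈ [y₀, y₁]`. [folklore] -/
theorem exists_abs_ge_add_mul_of_deriv_ge {f f' : ℝ → ℝ} (hf : ∀ y, HasDerivAt f (f' y) y) {v y₀ y₁ : ℝ} (hv : 0 < v)
    (hfv : ∀ y, v ≤ f' y) (h01 : y₀ ≤ y₁) :
    ∃ ys ∈ Icc y₀ y₁, ∀ y ∈ Icc y₀ y₁, |f ys| + v * |y - ys| ≤ |f y| := by
  have grow : ∀ x y : ℝ, x ≤ y → v * (y - x) ≤ f y - f x := fun x y hxy => mul_sub_le_sub_of_hasDerivAt_ge hf hfv hxy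
  by_cases h0 : 0 ≤ f y₀
  · refine ⟨y₀, left_mem_Icc.2 h01, fun y hy => ?_⟩
    have hg := grow y₀ y hy.1
    have hfy : 0 ≤ f y := by nlinarith [hy.1]
    rw [abs_of_nonneg h0, abs_of_nonneg hfy, abs_of_nonneg (sub_nonneg.2 hy.1)]
    linarith
  by_cases h1 : f y₁ ≤ 0
  · refine ⟨y₁, right_mem_Icc.2 h01, fun y hy => ?_⟩
    have hg := grow y y₁ hy.2
    have hfy : f y ≤ 0 := by nlinarith [hy.2]
    rw [abs_of_nonpos h1, abs_of_nonpos hfy, abs_of_nonpos (sub_nonpos.2 hy.2)]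
    linarith
  push Not at h0 h1
  have hcont : ContinuousOn f (Icc y₀ y₁) := fun z _ => (hf z).continuousAt.continuousWithinAt
  obtain ⟨ys, hys, hfs⟩ : ∃ ys ∈ Icc y₀ y₁, f ys = 0 :=
    intermediate_value_Icc h01 hcont ⟨h0.le, h1.le⟩
  refine ⟨ys, hys, fun y hy => ?_⟩
  rw [hfs, abs_zero, zero_add]
  rcases le_total ys y with hle | hle
  · have hg := grow ys y hle
    rw [hfs, sub_zero] at hg
    rw [abs_of_nonneg (sub_nonneg.2 hle), abs_of_nonneg (by nlinarith)]
    exact hg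
  · have hg := grow y ys hle
    rw [hfs, zero_sub] at hg
    rw [abs_of_nonpos (sub_nonpos.2 hle), abs_of_nonpos (by nlinarith)]
    linarith

/-- The same for a decreasing function (`f′ ≤ −v < 0`). [folklore] -/
theorem exists_abs_ge_add_mul_of_deriv_le {f f' : ℝ → ℝ} (hf : ∀ y, HasDerivAt f (f' y) y) {v y₀ y₁ : ℝ} (hv : 0 < v)
    (hfv : ∀ y, f' y ≤ -v) (h01 : y₀ ≤ y₁) :
    ∃ ys ∈ Icc y₀ y₁, ∀ y ∈ Icc y₀ y₁, |f ys| + v * |y - ys| ≤ |f y| := by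
  have hneg : ∀ y, HasDerivAt (fun t => -f t) (-f' y) y := fun y => (hf y).neg
  obtain ⟨ys, hys, h⟩ := exists_abs_ge_add_mul_of_deriv_ge hneg hv (fun y => by linarith [hfv y]) h01
  exact ⟨ys, hys, fun y hy => by simpa [abs_neg] using h y hy⟩

/-- **Slice datum, either orientation**: `f′ ≥ v` everywhere or `f′ ≤ −v` everywhere (`v > 0`). [folklore] -/
theorem exists_abs_ge_add_mul {f f' : ℝ → ℝ} (hf : ∀ y, HasDerivAt f (f' y) y) {v y₀ y₁ : ℝ} (hv : 0 < v)
    (hmono : (∀ y, v ≤ f' y) ∨ (∀ y, f' y ≤ -v)) (h01 : y₀ ≤ y₁) :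
    ∃ ys ∈ Icc y₀ y₁, ∀ y ∈ Icc y₀ y₁, |f ys| + v * |y - ys| ≤ |f y| :=
  hmono.elim (fun h => exists_abs_ge_add_mul_of_deriv_ge hf hv h h01) (fun h => exists_abs_ge_add_mul_of_deriv_le hf hv h h01)

/-- **Slice datum for the other function**: `|g′| ≤ m` everywhere ⇒ `|g y⋆| − m·|y − y⋆| ≤ |g y|`. [folklore] -/
theorem abs_sub_mul_le_abs_of_deriv {g g' : ℝ → ℝ} (hg : ∀ y, HasDerivAt g (g' y) y) {m : ℝ} (hm : ∀ y, |g' y| ≤ m)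
    (ys y : ℝ) : |g ys| - m * |y - ys| ≤ |g y| := by
  have h := abs_sub_le_mul_abs_of_hasDerivAt hg hm ys y
  have := abs_sub_abs_le_abs_sub (g ys) (g y)
  rw [abs_sub_comm (g ys) (g y)] at this
  linarith

/-! ## §3 Two functions on a rectangle: the cross-slice lower bound -/

/-- One axis-parallel mean value: `φ b − φ a = φ′(ξ)·(b − a)` for some `ξ ∈ uIcc a b`. [folklore] -/
theorem exists_sub_eq_deriv_mul {φ φ' : ℝ → ℝ} (hφ : ∀ s, HasDerivAt φ (φ' s) s) (a b : ℝ) :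
    ∃ ξ ∈ uIcc a b, φ b - φ a = φ' ξ * (b - a) := by
  rcases lt_trichotomy a b with hab | hab | hab
  · obtain ⟨c, hc, hcd⟩ := exists_hasDerivAt_eq_slope φ φ' hab
      (fun z _ => (hφ z).continuousAt.continuousWithinAt) (fun z _ => hφ z)
    refine ⟨c, ?_, ?_⟩
    · rw [uIcc_of_le hab.le]; exact Ioo_subset_Icc_self hc
    · rw [hcd, div_mul_cancel₀ _ (sub_ne_zero.2 hab.ne')]
  · exact ⟨a, by simp [hab], by simp [hab]⟩
  · obtain ⟨c, hc, hcd⟩ := exists_hasDerivAt_eq_slope φ φ' hab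
      (fun z _ => (hφ z).continuousAt.continuousWithinAt) (fun z _ => hφ z)
    refine ⟨c, ?_, ?_⟩
    · rw [uIcc_of_ge hab.le]; exact Ioo_subset_Icc_self hc
    · have hne : a - b ≠ 0 := sub_ne_zero.2 hab.ne'
      have : φ' c * (a - b) = φ a - φ b := by rw [hcd, div_mul_cancel₀ _ hne]
      linarith

/-- **Two-function mean-value LOWER bound on a rectangle** (the conditioning step of the tip rule): if every mixed choice of entries
`a = fx, b = fy, c = gx, d = gy` at (possibly different) points of `R = [x₀,x₁] × [y₀,y₁]` has `|a d − b c| ≥ J` and all `|∂| ≤ L` on `R`, then for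
`(x, y), (x′, y′) ∈ R`: `J·max(|x − x′|, |y − y′|) ≤ L·(|f(x,y) − f(x′,y′)| + |g(x,y) − g(x′,y′)|)` (Gate §5 `mv_matrix_bound`). [folklore] -/
theorem mv_lower_bound_rect {f g fx fy gx gy : ℝ → ℝ → ℝ}
    (hfx : ∀ x y, HasDerivAt (fun s => f s y) (fx x y) x) (hfy : ∀ x y, HasDerivAt (fun t => f x t) (fy x y) y)
    (hgx : ∀ x y, HasDerivAt (fun s => g s y) (gx x y) x) (hgy : ∀ x y, HasDerivAt (fun t => g x t) (gy x y) y)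
    {x₀ x₁ y₀ y₁ J L : ℝ}
    (hJ : ∀ x₁' ∈ Icc x₀ x₁, ∀ y₁' ∈ Icc y₀ y₁, ∀ x₂' ∈ Icc x₀ x₁, ∀ y₂' ∈ Icc y₀ y₁, ∀ x₃' ∈ Icc x₀ x₁, ∀ y₃' ∈ Icc y₀ y₁,
      ∀ x₄' ∈ Icc x₀ x₁, ∀ y₄' ∈ Icc y₀ y₁, J ≤ |fx x₁' y₁' * gy x₄' y₄' - fy x₂' y₂' * gx x₃' y₃'|)
    (hL : ∀ x ∈ Icc x₀ x₁, ∀ y ∈ Icc y₀ y₁, |fx x y| ≤ L ∧ |fy x y| ≤ L ∧ |gx x y| ≤ L ∧ |gy x y| ≤ L)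
    {x y x' y' : ℝ} (hx : x ∈ Icc x₀ x₁) (hy : y ∈ Icc y₀ y₁) (hx' : x' ∈ Icc x₀ x₁) (hy' : y' ∈ Icc y₀ y₁) :
    J * max |x - x'| |y - y'| ≤ L * (|f x y - f x' y'| + |g x y - g x' y'|) := by
  have hIx : uIcc x' x ⊆ Icc x₀ x₁ := uIcc_subset_Icc hx' hx
  have hIy : uIcc y' y ⊆ Icc y₀ y₁ := uIcc_subset_Icc hy' hy
  -- f x y − f x' y' = fx ξ₁ y (x − x') + fy x' η₁ (y − y')
  obtain ⟨ξ₁, hξ₁, e1⟩ := exists_sub_eq_deriv_mul (fun s => hfx s y) x' x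
  obtain ⟨η₁, hη₁, e2⟩ := exists_sub_eq_deriv_mul (fun t => hfy x' t) y' y
  obtain ⟨ξ₂, hξ₂, e3⟩ := exists_sub_eq_deriv_mul (fun s => hgx s y) x' x
  obtain ⟨η₂, hη₂, e4⟩ := exists_sub_eq_deriv_mul (fun t => hgy x' t) y' y
  have hf : f x y - f x' y' = fx ξ₁ y * (x - x') + fy x' η₁ * (y - y') := by
    have : f x y - f x' y' = (f x y - f x' y) + (f x' y - f x' y') := by ring
    rw [this, e1, e2]
  have hg : g x y - g x' y' = gx ξ₂ y * (x - x') + gy x' η₂ * (y - y') := by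
    have : g x y - g x' y' = (g x y - g x' y) + (g x' y - g x' y') := by ring
    rw [this, e3, e4]
  rw [hf, hg]
  have hJ' := hJ ξ₁ (hIx hξ₁) y hy x' hx' η₁ (hIy hη₁) ξ₂ (hIx hξ₂) y hy x' hx' η₂ (hIy hη₂)
  exact mv_matrix_bound hJ' (hL ξ₁ (hIx hξ₁) y hy).1 (hL x' hx' η₁ (hIy hη₁)).2.1 (hL ξ₂ (hIx hξ₂) y hy).2.2.1
    (hL x' hx' η₂ (hIy hη₂)).2.2.2

/-- **At a minimiser of `|f| + |g|` on the rectangle**: `(J/(2L))·max(|x − x′|, |y − y′|) ≤ |f(x,y)| + |g(x,y)|` (`L > 0`). [folklore] -/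
theorem sum_abs_ge_of_isMinOn {f g fx fy gx gy : ℝ → ℝ → ℝ}
    (hfx : ∀ x y, HasDerivAt (fun s => f s y) (fx x y) x) (hfy : ∀ x y, HasDerivAt (fun t => f x t) (fy x y) y)
    (hgx : ∀ x y, HasDerivAt (fun s => g s y) (gx x y) x) (hgy : ∀ x y, HasDerivAt (fun t => g x t) (gy x y) y)
    {x₀ x₁ y₀ y₁ J L : ℝ} (hLpos : 0 < L)
    (hJ : ∀ x₁' ∈ Icc x₀ x₁, ∀ y₁' ∈ Icc y₀ y₁, ∀ x₂' ∈ Icc x₀ x₁, ∀ y₂' ∈ Icc y₀ y₁, ∀ x₃' ∈ Icc x₀ x₁, ∀ y₃' ∈ Icc y₀ y₁,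
      ∀ x₄' ∈ Icc x₀ x₁, ∀ y₄' ∈ Icc y₀ y₁, J ≤ |fx x₁' y₁' * gy x₄' y₄' - fy x₂' y₂' * gx x₃' y₃'|)
    (hL : ∀ x ∈ Icc x₀ x₁, ∀ y ∈ Icc y₀ y₁, |fx x y| ≤ L ∧ |fy x y| ≤ L ∧ |gx x y| ≤ L ∧ |gy x y| ≤ L)
    {x' y' : ℝ} (hx' : x' ∈ Icc x₀ x₁) (hy' : y' ∈ Icc y₀ y₁)
    (hmin : ∀ x ∈ Icc x₀ x₁, ∀ y ∈ Icc y₀ y₁, |f x' y'| + |g x' y'| ≤ |f x y| + |g x y|)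
    {x y : ℝ} (hx : x ∈ Icc x₀ x₁) (hy : y ∈ Icc y₀ y₁) :
    J / (2 * L) * max |x - x'| |y - y'| ≤ |f x y| + |g x y| := by
  have h := mv_lower_bound_rect hfx hfy hgx hgy hJ hL hx hy hx' hy'
  have h1 : |f x y - f x' y'| ≤ |f x y| + |f x' y'| := abs_sub _ _
  have h2 : |g x y - g x' y'| ≤ |g x y| + |g x' y'| := abs_sub _ _
  have hm := hmin x hx y hy
  have : J * max |x - x'| |y - y'| ≤ L * (2 * (|f x y| + |g x y|)) := by nlinarith [h1, h2, hm, hLpos]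
  rw [div_mul_eq_mul_div, div_le_iff₀ (by positivity)]
  linarith

/-- A continuous function of two variables attains its minimum on a closed rectangle. [folklore] -/
theorem exists_isMinOn_rect {F : ℝ → ℝ → ℝ} (hF : Continuous fun p : ℝ × ℝ => F p.1 p.2) {x₀ x₁ y₀ y₁ : ℝ} (hx : x₀ ≤ x₁) (hy : y₀ ≤ y₁) :
    ∃ x' ∈ Icc x₀ x₁, ∃ y' ∈ Icc y₀ y₁, ∀ x ∈ Icc x₀ x₁, ∀ y ∈ Icc y₀ y₁, F x' y' ≤ F x y := by
  have hK : IsCompact (Icc x₀ x₁ ×ˢ Icc y₀ y₁) := isCompact_Icc.prod isCompact_Icc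
  have hne : (Icc x₀ x₁ ×ˢ Icc y₀ y₁).Nonempty := ⟨(x₀, y₀), ⟨left_mem_Icc.2 hx, left_mem_Icc.2 hy⟩⟩
  obtain ⟨p, hp, hmin⟩ := hK.exists_isMinOn hne hF.continuousOn
  refine ⟨p.1, hp.1, p.2, hp.2, fun x hx' y hy' => ?_⟩
  exact hmin (show (x, y) ∈ Icc x₀ x₁ ×ˢ Icc y₀ y₁ from ⟨hx', hy'⟩)

end Summit.HubbardSuperconductivity.HubbardSuperconductivity.Theorems.KlLindhardEnclosure

end
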